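import Summits.CriticalPhenomena.PercolationContinuityZ3.Theorems.FK.Transplant.UFSC0SlabBoxDomination
import Summits.CriticalPhenomena.PercolationContinuityZ3.Theorems.FK.Transplant.UFSC0SlabBoxDriver
import Summits.CriticalPhenomena.PercolationContinuityZ3.Theorems.Transplant.KNCells2ZdGeom
import HarnessLib

/-!
# FRONTIER TRANSPLANT — K1 in finite form (K1-FIN), piece (P3a): Kozma–Nitzan's run under the free law of a FINITE slab
# box reaches every good macro-site — `(5/6) μ_N(A₀) ≤ μ_N(A₀ ∩ {y occupied})` — and what an occupied site certifies

Support file (`--supports stmt-CriticalPhenomena-4575`, helper) of the FRONTIER TRANSPLANT sub-cell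
(`fk-continuity/transplant/`, seat `prim-bschramm-fkt-p3`); builds on p205010 (kernel theorem, internal audit signed;
external expert review pending). Memo row K1-FIN [g130, R67] (bytes-first package). 0 named facts · 0 sorries ·
standard axioms; `FH` does not occur in this file; `UFSC0`'s two clauses enter as displayed hypotheses.
Registered R70 (cell INBOX l.5267, 2026-08-23); registry row T4k; lead label T4k-07 (fkt-lead L44, l.5255).
Gate-prescribed dedup (dry-run `dedup.landed`, 2026-08-23T22:22Z; R70 (γ) stated delta): the private copy
`abs_stepVec_apply_le` is deleted in favour of the landed `Transplant.KNCells.ZdReg.abs_stepVec_le` (`KNCells2ZdGeom`).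

HONEST FRAMING (page 1, cell rule). The transplant's theorem of record `ufsc0_of_freeBoundaryHypothesis_r3` is
CONDITIONAL on FH AND on TP_FK, both OPEN at the same `p` for `q > 1` (⇔ GRC Conj. (5.103) via K1; barrier note
`Literature.Barriers.CriticalPhenomena.SamePFreeBoundaryCriteria`, FBN-01); the transplant is a typed reduction, not a
proof of FK continuity. K1-FIN (`(∃ r, UFSC0) ⟹ (∃ L, Π(p, L))`) changes nothing in the record (`_r3` « 2 / 0 ☑ »,
n_open = 2).

## What is here (namespace `Summit.CriticalPhenomena.PercolationContinuityZ3.Theorems.FK`)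

* `slabW`, `slabBox S N` — the slab box `Λ_N = {|x_j| ≤ 5r (j ∉ {ax0, ax1}), |x_{ax0}|, |x_{ax1}| ≤ N}` of the scheme `S`
  (Grimmett's `S(L, N)` with `L = 5r`, in Kozma–Nitzan's orientation), as an order interval;
* `planar_and_thin_of_mem_Cell` and **`fresh_subset_slabBox`** — the GEOMETRY: after an FK-valid history, every fresh lattice
  edge of every examination region `Sx h e du` of a target in the macro-box `Λ_n` lies inside `Λ_N` once
  `20r(n+1) + 10r + 1 ≤ N` (the explored region may stick out in the plane, but it is pinned; KN's boxes
  `E_{w,v}`, `E_{v,x}` lie in the cells of `w`, `v`, `x`);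
* **`SameP.condLawfulOn_schemeFK_slabBox`** — from the two clauses of `UFSC0` for `S`, KN's FK scheme is conditionally
  lawful at `4ε₀` under the free law of `Λ_N` ON the macro-box `Λ_n` (C3b `fkRobustLawful_knScheme` + file (P1));
* **`SameP.le_fkLaw_slabBox_real_initEvent_inter_mem`** — hence, for `4ε₀ ≤ 2⁻³²` and `y ∈ Λ_n`,
  `(5/6) μ_N(A₀) ≤ μ_N(A₀ ∩ {y ∈ final cluster})` (file (P2c));
* `RunFK.exists_pathIn_near_of_mem_occFinal` — an occupied macro-site `b` certifies an `ω`-open path inside the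
  explored region from `0` to a point within planar sup-distance `16r` of `cen b` (the tree's `exists_exit`, as in
  `RunFK.mem_percolatesVia_of_infinite`).

## References

* G. Kozma, S. Nitzan, arXiv:2401.12397 (2024), §4 pp. 25–31 (Theorem 6, (32)–(33)) [KozmaNitzan2024].
* G. Grimmett, *The Random-Cluster Model*, Springer 2006, §5.7 (5.102), Conj. (5.103); Lemma (4.13) [Grimmett2006].
-/

noncomputable section

namespace Summit.CriticalPhenomena.PercolationContinuityZ3.Theorems.FK

open MeasureTheory Literature.Probability.Percolation Literature.Probability.LatticeModels
open Literature.Probability.Percolation.ProbeHistory Literature.Probability.Percolation.HSiteScheme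
open Literature.Probability.Percolation.KozmaNitzan Literature.Probability.Percolation.GadgetSystem
open KSch Cells
open scoped ENNReal Classical

variable {d : ℕ}

/-! ### §1 The slab box of the scheme -/

/-- The half-widths of the slab box: `N` in the two planar directions of the scheme, `5r` across.
[cite: Grimmett2006, §5.7 (S(L, n)); KozmaNitzan2024, §4 p. 26] -/
def slabW (S : KSch d) (N : ℕ) : Site d := fun j => if j = S.C.ax0 ∨ j = S.C.ax1 then (N : ℤ) else 5 * S.C.r

/-- **The slab box `Λ_N`** of the scheme `S`: `{x : |x_j| ≤ 5r for j ∉ {ax0, ax1}, |x_{ax0}| ≤ N, |x_{ax1}| ≤ N}`, as the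
order interval `Icc (-slabW) slabW`. [cite: Grimmett2006, §5.7 (S(L, n)), Conj. (5.103)] -/
def slabBox (S : KSch d) (N : ℕ) : Finset (Site d) := Finset.Icc (-slabW S N) (slabW S N)

variable {S : KSch d} {q : ℝ}

/-- Membership in the slab box, coordinatewise. [folklore] -/
theorem mem_slabBox_iff {N : ℕ} {x : Site d} : x ∈ slabBox S N ↔ ∀ j, |x j| ≤ slabW S N j := by
  rw [slabBox, Finset.mem_Icc, Pi.le_def, Pi.le_def]
  constructor
  · rintro ⟨h1, h2⟩ j
    have := h1 j; have := h2 j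
    rw [abs_le]; exact ⟨by simpa using h1 j, h2 j⟩
  · intro h
    refine ⟨fun j => ?_, fun j => ?_⟩
    · have := (abs_le.1 (h j)).1; simpa using this
    · exact (abs_le.1 (h j)).2

/-- The planar axis of a planar index is `ax0` or `ax1`. [folklore] -/
theorem pax_eq_or (S : KSch d) (i : Fin 2) : S.C.pax i = S.C.ax0 ∨ S.C.pax i = S.C.ax1 := by
  unfold Cells.pax; split_ifs
  · exact Or.inl rfl
  · exact Or.inr rfl

/-- The planar half-widths are `N`. [folklore] -/
theorem slabW_pax (S : KSch d) (N : ℕ) (i : Fin 2) : slabW S N (S.C.pax i) = N := by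
  unfold slabW; rw [if_pos (pax_eq_or S i)]

/-- The transverse half-widths are `5r`. [folklore] -/
theorem slabW_of_ne (S : KSch d) (N : ℕ) {j : Fin d} (h0 : j ≠ S.C.ax0) (h1 : j ≠ S.C.ax1) : slabW S N j = 5 * S.C.r := by
  unfold slabW; rw [if_neg]; push Not; exact ⟨h0, h1⟩

/-- The origin lies in the slab box. [folklore] -/
theorem zero_mem_slabBox (S : KSch d) (N : ℕ) : (0 : Site d) ∈ slabBox S N := by
  rw [mem_slabBox_iff]; intro j; unfold slabW; split_ifs <;> simp

/-- **Coordinatewise membership in the slab box from planar and transverse bounds.** [folklore] -/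
theorem mem_slabBox_of_bounds {N : ℕ} {x : Site d} (hthin : ∀ j, j ≠ S.C.ax0 → j ≠ S.C.ax1 → |x j| ≤ 5 * S.C.r)
    (hplane : ∀ i : Fin 2, |x (S.C.pax i)| ≤ N) : x ∈ slabBox S N := by
  rw [mem_slabBox_iff]
  intro j
  have hp0 : S.C.pax 0 = S.C.ax0 := by unfold Cells.pax; rw [if_pos rfl]
  have hp1 : S.C.pax 1 = S.C.ax1 := by unfold Cells.pax; rw [if_neg (by decide)]
  by_cases h0 : j = S.C.ax0
  · have h := hplane 0
    have hw := slabW_pax S N 0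
    rw [hp0] at h hw
    rw [h0, hw]; exact h
  · by_cases h1 : j = S.C.ax1
    · have h := hplane 1
      have hw := slabW_pax S N 1
      rw [hp1] at h hw
      rw [h1, hw]; exact h
    · rw [slabW_of_ne S N h0 h1]; exact hthin j h0 h1

/-! ### §2 Geometry: cells and fresh examination edges inside the slab box -/

-- The unit steps of the macro-lattice change each coordinate by at most `1`: the landed
-- `Transplant.KNCells.ZdReg.abs_stepVec_le` (module `KNCells2ZdGeom`) is reused (gate-prescribed dedup).
open Summit.CriticalPhenomena.PercolationContinuityZ3.Theorems.Transplant.KNCells.ZdReg (abs_stepVec_le)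

/-- A macro-neighbour of a site of `Λ_n` lies in `Λ_{n+1}`. [folklore] -/
theorem add_stepVec_mem_box {n : ℕ} {u : Site 2} (hu : u ∈ box 2 n) (δ : MDir) : u + stepVec δ ∈ box 2 (n + 1) := by
  rw [mem_box] at hu ⊢
  intro i
  have h1 := hu i
  have h2 := abs_le.1 (abs_stepVec_le δ i)
  simp only [Pi.add_apply]; push_cast; omega

/-- A site whose macro-neighbour lies in `Λ_n` lies in `Λ_{n+1}`. [folklore] -/
theorem mem_box_of_add_stepVec_mem {n : ℕ} {u : Site 2} (δ : MDir) (hu : u + stepVec δ ∈ box 2 n) : u ∈ box 2 (n + 1) := by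
  rw [mem_box] at hu ⊢
  intro i
  have h1 := hu i
  have h2 := abs_le.1 (abs_stepVec_le δ i)
  simp only [Pi.add_apply] at h1; push_cast; omega

/-- **A cell of a macro-site of `Λ_m` has planar coordinates at most `20rm + 10r` and lies in the slab.** [cite: KozmaNitzan2024, §4 p. 26 (the cells)] -/
theorem planar_and_thin_of_mem_Cell {m : ℕ} {u : Site 2} (hu : u ∈ box 2 m) {x : Site d} (hx : x ∈ S.C.Cell u) :
    (∀ i : Fin 2, |x (S.C.pax i)| ≤ 20 * S.C.r * m + 10 * S.C.r) ∧
      ∀ j, j ≠ S.C.ax0 → j ≠ S.C.ax1 → |x j| ≤ 5 * S.C.r := by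
  refine ⟨fun i => ?_, fun j h0 h1 => ?_⟩
  · have h := S.C.planar_of_mem_Cell hx i
    have hui := abs_le.1 (show |u i| ≤ (m : ℤ) by have := (mem_box.1 hu) i; rw [abs_le]; exact this)
    have hr : (0 : ℤ) ≤ S.C.r := by positivity
    rw [abs_le]; constructor <;> nlinarith [h.1, h.2, hui.1, hui.2]
  · have hslab : x ∈ S.slab := S.Cover_subset_slab {u} (S.C.subset_cover (Set.mem_singleton u) (Or.inl hx))
    exact hslab j h0 h1

/-- **The fresh edges of an examination of a target in `Λ_n` lie inside the slab box `Λ_N`**, `20r(n+1) + 10r + 1 ≤ N`: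
after an FK-valid history `h`, every lattice edge of `Sx h e du = E_i ∪ E_{w,v} ∪ E_{v,x}` not already revealed has an
endpoint in `E_{w,v} ∪ E_{v,x}` (inside the cells of `w`, `v`, `x ∈ Λ_{n+1}`: planar coordinates `≤ N - 1`, transverse
`≤ 5r`), and its other endpoint, if in the explored region `E_i ⊆ slab`, is a lattice neighbour of the first.
[cite: KozmaNitzan2024, §4 pp. 26–27 (E_i, E_{w,v}, E_{v,x}, (29))] -/
theorem fresh_subset_slabBox {h : ProbeHistory (Site d)} {e : Site 2 × MDir} (hV : ValidFK S q h e) (du : MDir)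
    {n N : ℕ} (hN : 20 * S.C.r * (n + 1) + 10 * S.C.r + 1 ≤ N) (ht : tgt e ∈ box 2 n) :
    ∀ e' ∈ SameP.freshOf (schemeFK S q) h (S.Sx h e du), ∀ x ∈ e', x ∈ slabBox S N := by
  intro e' he' x hx
  have hfresh : e' ∈ edgesIn (zdGraph d) (S.Sx h e du) ∧ e' ∉ S.F h := by
    have := Finset.mem_sdiff.1 he'
    exact ⟨this.1, this.2⟩
  obtain ⟨he'in, he'F⟩ := hfresh
  rw [hV.F_eq] at he'F
  rw [mem_edgesIn_iff] at he'in he'F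
  obtain ⟨he'E, he'Sx⟩ := he'in
  -- the three macro-sites involved lie in `Λ_{n+1}`
  have hsrc : e.1 ∈ box 2 (n + 1) := mem_box_of_add_stepVec_mem e.2 ht
  have htgt : tgt e ∈ box 2 (n + 1) := box_mono 2 (Nat.le_succ n) ht
  have hx' : tgt e + stepVec du ∈ box 2 (n + 1) := add_stepVec_mem_box ht du
  -- points of `E_{w,v} ∪ E_{v,x}`: planar coordinates `≤ N - 1`, transverse `≤ 5r`
  have hnew : ∀ y ∈ S.C.Ewv e.1 e.2 ∪ S.C.Efar (tgt e) du,
      (∀ i : Fin 2, |y (S.C.pax i)| ≤ (N : ℤ) - 1) ∧ ∀ j, j ≠ S.C.ax0 → j ≠ S.C.ax1 → |y j| ≤ 5 * S.C.r := by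
    intro y hy
    have hcell : ∃ u ∈ box 2 (n + 1), y ∈ S.C.Cell u := by
      rcases Finset.mem_union.1 hy with hy | hy
      · rcases Finset.mem_union.1 (S.C.Ewv_subset_Cells e.1 e.2 hy) with h' | h'
        · exact ⟨e.1, hsrc, h'⟩
        · exact ⟨tgt e, htgt, h'⟩
      · rcases Finset.mem_union.1 (S.C.Ewv_subset_Cells (tgt e) du (S.C.Efar_subset_Ewv (tgt e) du hy)) with h' | h'
        · exact ⟨tgt e, htgt, h'⟩
        · exact ⟨tgt e + stepVec du, hx', h'⟩
    obtain ⟨u, hu, hyu⟩ := hcell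
    obtain ⟨hpl, hth⟩ := planar_and_thin_of_mem_Cell hu hyu
    refine ⟨fun i => ?_, hth⟩
    have := hpl i
    push_cast at this hN ⊢
    linarith
  -- the explored region lies in the slab
  have hVslab : (↑(S.V h) : Set (Site d)) ⊆ S.slab := by
    obtain ⟨det, -, -, hcov⟩ := hV.cover
    exact hcov.trans (S.Cover_subset_slab det)
  -- the endpoint `x` and the other endpoint `x'`
  obtain ⟨x', hx'e, hxx'⟩ : ∃ x', x' ∈ e' ∧ e' = s(x, x') := by
    obtain ⟨x', rfl⟩ := Sym2.mem_iff_exists.1 hx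
    exact ⟨x', Sym2.mem_mk_right _ _, rfl⟩
  subst hxx'
  have hadj : (zdGraph d).Adj x x' := he'E
  refine mem_slabBox_of_bounds (fun j h0 h1 => ?_) (fun i => ?_)
  · -- transverse coordinates: `x ∈ Sx ⊆ slab`
    rcases Finset.mem_union.1 (he'Sx x hx) with h1' | h1'
    · rcases Finset.mem_union.1 h1' with hV' | hE
      · exact hVslab (Finset.mem_coe.2 hV') j h0 h1
      · exact (hnew x (Finset.mem_union_left _ hE)).2 j h0 h1
    · exact (hnew x (Finset.mem_union_right _ h1')).2 j h0 h1
  · -- planar coordinates: `x` is new, or a lattice neighbour of the new point `x'`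
    by_cases hxV : x ∈ S.V h
    · have hx'V : x' ∉ S.V h := fun h' => he'F ⟨he'E, fun y hy => by
        rcases Sym2.mem_iff.1 hy with rfl | rfl
        · exact hxV
        · exact h'⟩
      have hx'new : x' ∈ S.C.Ewv e.1 e.2 ∪ S.C.Efar (tgt e) du := by
        rcases Finset.mem_union.1 (he'Sx x' hx'e) with h1' | h1'
        · rcases Finset.mem_union.1 h1' with hV' | hE
          · exact absurd hV' hx'V
          · exact Finset.mem_union_left _ hE
        · exact Finset.mem_union_right _ h1'
      have h1 := (hnew x' hx'new).1 i
      have h2 := abs_sub_le_one_of_adj hadj (S.C.pax i)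
      rw [abs_le] at h1 h2 ⊢; constructor <;> linarith [h1.1, h1.2, h2.1, h2.2]
    · have hxnew : x ∈ S.C.Ewv e.1 e.2 ∪ S.C.Efar (tgt e) du := by
        rcases Finset.mem_union.1 (he'Sx x hx) with h1' | h1'
        · rcases Finset.mem_union.1 h1' with hV' | hE
          · exact absurd hV' hxV
          · exact Finset.mem_union_left _ hE
        · exact Finset.mem_union_right _ h1'
      have h1 := (hnew x hxnew).1 i
      rw [abs_le] at h1 ⊢; constructor <;> linarith [h1.1, h1.2]

/-! ### §3 The scheme is conditionally lawful under the free law of the slab box, on the macro-box -/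

namespace SameP

/-- **Kozma–Nitzan's FK scheme is conditionally lawful at `4ε₀` under the free law of the slab box `Λ_N`, ON the
macro-box `Λ_n`** (`20r(n+1) + 10r + 1 ≤ N`, `q ≥ 1`), from the two clauses of `UFSC0` for `S` ((32)-FK at the origin,
the per-direction minimal-law bound `≤ ε₀` after FK-valid histories) and `δ ≤ 1`: C3b's `fkRobustLawful_knScheme` read as a
pinned scheme, then file (P1)'s `PinnedLawful.condLawfulOn_fkLaw` with the geometry `fresh_subset_slabBox`.
[cite: KozmaNitzan2024, §4 pp. 25–31 (Theorem 6, (32)–(33)); Grimmett2006, Lemma (4.13), Lemma (4.14)(b)] -/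
theorem condLawfulOn_schemeFK_slabBox (hq : 1 ≤ q) {ε₀ : ℝ} (hδ1 : S.δc ≤ 1) (hQ0 : ∀ du : MDir, OriginFK S q du)
    (hbad : ∀ (h : ProbeHistory (Site d)) (e : Site 2 × MDir) (du : MDir), ValidFK S q h e →
      du ∈ S.onward h (tgt e) → (fkLaw (S.Sx h e du) (S.Wfull h e du) q).real (badFK S q h e du) ≤ ε₀)
    {n N : ℕ} (hN : 20 * S.C.r * (n + 1) + 10 * S.C.r + 1 ≤ N) :
    CondLawfulOn (schemeFK S q) (fkLaw (slabBox S N) (restrW (↑(slabBox S N) : Set (Site d)) (lattW d S.p)) q)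
      (zdGraph d) (4 * ε₀) (↑(box 2 n) : Set (Site 2)) := by
  have hR := fkRobustLawful_knScheme (S := S) hq hQ0 hbad
  have hSnd := knScheme_sound (S := S) hq hδ1 hQ0
  have hPL : PinnedLawful (knScheme S q).toHSiteScheme q S.p (4 * ε₀) (knFreshBound S)
      (knScheme S q).dirs (knScheme S q).reg (knScheme S q).bad :=
    ⟨hR.probes, hSnd.1, hR.cover, hR.lower, hR.determined, hR.freshCard, hR.fail⟩
  refine hPL.condLawfulOn_fkLaw hq (slabBox S N) (↑(box 2 n) : Set (Site 2)) fun h Pr e hPr he hge du hdu => ?_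
  obtain ⟨e', hc', hV, -⟩ := nextProbeFK_eq_some (S := S) (q := q) hPr
  have hee : e' = e := Option.some_injective _ (hc'.symm.trans he)
  subst hee
  exact fresh_subset_slabBox hV du hN (Finset.mem_coe.1 hge)

/-- **The run reaches every good macro-site**: under the free law `μ_N` of the slab box `Λ_N`, for `4ε₀ ≤ 2⁻³²`,
`20r(n+1) + 10r + 1 ≤ N` and every macro-site `y ∈ Λ_n`, `(5/6) μ_N(A₀) ≤ μ_N(A₀ ∩ {y ∈ final macro-cluster})` — the
point-to-point Peierls estimate of file (P2c) for the conditionally lawful scheme above.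
[cite: KozmaNitzan2024, §4 Theorem 6 (pp. 25–31); Grimmett2006, §5.7 (5.102)] -/
theorem le_fkLaw_slabBox_real_initEvent_inter_mem (hq : 1 ≤ q) {ε₀ : ℝ} (hε : 4 * ε₀ ≤ (1 / 2 : ℝ) ^ 32)
    (hδ1 : S.δc ≤ 1) (hQ0 : ∀ du : MDir, OriginFK S q du)
    (hbad : ∀ (h : ProbeHistory (Site d)) (e : Site 2 × MDir) (du : MDir), ValidFK S q h e →
      du ∈ S.onward h (tgt e) → (fkLaw (S.Sx h e du) (S.Wfull h e du) q).real (badFK S q h e du) ≤ ε₀)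
    {n N : ℕ} (hN : 20 * S.C.r * (n + 1) + 10 * S.C.r + 1 ≤ N) {y : Site 2} (hy : y ∈ box 2 n) :
    5 / 6 * (fkLaw (slabBox S N) (restrW (↑(slabBox S N) : Set (Site d)) (lattW d S.p)) q).real (schemeFK S q).initEvent ≤
      (fkLaw (slabBox S N) (restrW (↑(slabBox S N) : Set (Site d)) (lattW d S.p)) q).real
        ((schemeFK S q).initEvent ∩ {ω | y ∈ (schemeFK S q).occFinal ω}) := by
  haveI := (isPinningLaw_fkLaw (slabBox S N) hq).prob (restrW (↑(slabBox S N) : Set (Site d)) (lattW d S.p))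
  exact (condLawfulOn_schemeFK_slabBox hq hδ1 hQ0 hbad hN).le_measureReal_initEvent_inter_mem hε subset_rfl hy

end SameP

/-! ### §4 What an occupied macro-site certifies -/

namespace RunFK

/-- **An occupied macro-site certifies an open path to its vicinity** (KN p. 26, (3), via the tree's `exists_exit`): on
the initial event, if `b` lies in the final macro-cluster of the FK run on `ω`, then some point `a` within planar
sup-distance `16r` of `cen b` is joined to `0` by an `ω`-open lattice path INSIDE THE EXPLORED REGION (hence inside the
slab). The extraction is the one of `RunFK.mem_percolatesVia_of_infinite`. [cite: KozmaNitzan2024, §4 pp. 26–28 ((3), (32))] -/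
theorem exists_pathIn_near_of_mem_occFinal (hq : 1 ≤ q) (hδc : S.δc ≤ 1) (hQ0 : ∀ du : MDir, OriginFK S q du)
    {ω : BondConfig (Site d)} (hA : ω ∈ (schemeFK S q).initEvent) {b : Site 2} (hb : b ∈ (schemeFK S q).occFinal ω) :
    ∃ a : Site d, (∃ m : ℕ, PathIn (openGraph ω) (↑(S.V (hst S q ω m)) : Set (Site d)) 0 a) ∧
      ∀ i : Fin 2, |20 * (S.C.r : ℤ) * b i - a (S.C.pax i)| ≤ 16 * S.C.r := by
  have hr1 : (1 : ℤ) ≤ S.C.r := by exact_mod_cast S.C.r_pos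
  by_cases hb0 : b = 0
  · subst hb0
    refine ⟨0, ⟨0, PathIn.refl (Finset.mem_coe.2 (zero_mem_V (S := S) (q := q) (ω := ω) 0))⟩, fun i => ?_⟩
    simp only [Pi.zero_apply, mul_zero, zero_sub, abs_neg, abs_zero]
    positivity
  obtain ⟨n, hbn⟩ := Set.mem_iUnion.1 hb
  rcases (schemeFK S q).exists_probe_of_det ω n b (Or.inl hbn) with h | ⟨m, -, e, P, hc, hte, hP, -⟩
  · exact absurd h hb0
  obtain ⟨e', hc', -, rfl⟩ := of_next_some (S := S) (q := q) hP
  have hee : e' = e := Option.some_injective _ (hc'.symm.trans hc)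
  subst hee
  have hV : ValidFK S q (hst S q ω m) e' := validFK_of_choice hq hQ0 hc
  obtain ⟨a, -, hpa, b', hb', hab⟩ := exists_exit hq hδc hA hV
  refine ⟨a, ⟨m, hpa⟩, fun i => ?_⟩
  subst hte
  have htgt : tgt e' = e'.1 + stepVec e'.2 := rfl
  rw [htgt]
  have hab1 := abs_sub_le_one_of_adj hab (S.C.pax i)
  have hb'c : |b' (S.C.pax i) - 20 * S.C.r * (e'.1 + stepVec e'.2) i| ≤ 15 * S.C.r := by
    rcases Finset.mem_union.1 hb' with h | h
    · obtain ⟨⟨hl1, hl2⟩, ht1, ht2⟩ := S.C.planar_of_mem_sBox h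
      by_cases hi : i = e'.2.1
      · subst hi
        have hta : (e'.1 + stepVec e'.2) e'.2.1 = e'.1 e'.2.1 + sgOf e'.2 := by
          rw [Pi.add_apply, stepVec_apply_fst]
        rw [hta, abs_le]
        rcases sgOf_sign e'.2 with hs | hs <;> rw [hs] at hl1 hl2 ⊢ <;> constructor <;> nlinarith
      · have hi' : i = oth e'.2.1 := eq_oth_of_ne hi
        subst hi'
        have hta : (e'.1 + stepVec e'.2) (oth e'.2.1) = e'.1 (oth e'.2.1) := by
          rw [Pi.add_apply, stepVec_apply_oth, add_zero]
        rw [hta, abs_le]; constructor <;> linarith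
    · have := S.C.planar_of_mem_cIcc h i
      push_cast at this
      rw [abs_le]; constructor <;> linarith [this.1, this.2]
  have := abs_sub_abs_le_abs_sub (20 * (S.C.r : ℤ) * (e'.1 + stepVec e'.2) i - a (S.C.pax i))
    (20 * S.C.r * (e'.1 + stepVec e'.2) i - b' (S.C.pax i))
  have e1 : 20 * (S.C.r : ℤ) * (e'.1 + stepVec e'.2) i - a (S.C.pax i) -
      (20 * S.C.r * (e'.1 + stepVec e'.2) i - b' (S.C.pax i)) = b' (S.C.pax i) - a (S.C.pax i) := by ring
  rw [e1] at this
  rw [abs_sub_comm] at hb'c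
  linarith

end RunFK

end Summit.CriticalPhenomena.PercolationContinuityZ3.Theorems.FK

end
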